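import Summits.Ventures.HodgeRepro2.T5BergmanSchur
import Summits.Ventures.HodgeRepro2.T5BergmanU11

/-!
# Schur orthogonality on `H_j = U(1,1)` for the lowest-weight vector against every vector

On `U(1,1) = Z · SU(1,1)` the weight-`k` model `actU` (`T5BergmanU11`) has central character `λ ↦ λ^k`,
so the matrix coefficient `⟨π_k(λ g) 1, h⟩_k = λ^k ⟨π_k(g) 1, h⟩_k` has `|⟨π_k(λ g) 1, h⟩|²` invariant
under the centre (`norm_coeffLowestU_mulHom`).  Through the product formula for the Haar measure of
`U(1,1)` (`T5U11Product.integral_eq_of_scalar_invariant`) the `SU(1,1)` Schur relation of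
`T5BergmanSchur` becomes, for every Haar measure `μ_U` of `U(1,1)` and every `h ∈ A_k`:

  `c_U • ∫_{U(1,1)} |⟨π_k(g) 1, h⟩_k|² dμ_U = (π/(k-1))² ⟨h, h⟩_k`   (`integral_norm_coeffLowestU_sq`),

with `c_U = haarScalarFactor (map mulHom (haarCircle ⊗ ν)) μ_U > 0` — S4 l. 83's «`∫_{H_j} |⟨π f, f⟩|² =
‖f‖⁴ vol(Z_j) κ_j / 2`» for the pair `(1, h)` and every weight `k` (the `§24` statement
`T5BergmanU11.integral_norm_coeffU_sq` is `k = 3`, `h = 1`); in particular the integral is POSITIVE for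
`h ≠ 0` (`integral_norm_coeffLowestU_sq_pos`).

Blind lane: Mathlib + the HodgeRepro2 prefix only; no sorry; axioms ⊆ {propext, Classical.choice,
Quot.sound}.
-/

namespace Summit.Ventures.HodgeRepro2.T5BergmanSchurU11

open MeasureTheory MeasureTheory.Measure Metric Filter Topology
open T5PoincareMeasure T5SU11Unimodular T5U11Unimodular T5U11Product T5SU11Fibration
  T5SU11FibrationHaar T5SU11FibrationCartan T5HaarCircle T5SU11CoefficientL2 T5U11CoefficientL2
open T5BergmanCoefficient T5BergmanPairing T5BergmanUnitary T5BergmanCoefficientL2 T5BergmanU11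
  T5BergmanParseval T5BergmanFourier T5BergmanKernel T5BergmanSchur
open Matrix hiding J
open scoped ENNReal NNReal Real

/-- The matrix coefficient of the lowest-weight vector against `h` on `U(1,1)`: `g ↦ ⟨π_k(g) 1, h⟩_k`. -/
noncomputable def coeffLowestU (k : ℕ) (h : ℂ → ℂ) (g : U11) : ℂ := pairing k (actU k g lowest) h

/-- `⟨π_k(λ g) 1, h⟩_k = λ^k ⟨π_k(g) 1, h⟩_k` for `g ∈ SU(1,1)` embedded in `U(1,1)`. -/
theorem coeffLowestU_mulHom (k : ℕ) (h : ℂ → ℂ) (lam : Circle) (g : SU11) :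
    coeffLowestU k h (mulHom (lam, g)) = (lam : ℂ) ^ k * coeffLowest k h g := by
  unfold coeffLowestU coeffLowest
  have e : ∀ z ∈ ball (0 : ℂ) 1, actU k (mulHom (lam, g)) lowest z = (lam : ℂ) ^ k * act k g lowest z :=
    fun z _ => actU_mulHom k lam g lowest z
  rw [pairing_congr e (fun _ _ => rfl), pairing_const_mul_left]

/-- The square of the coefficient is invariant under the centre: `|⟨π_k(λ g) 1, h⟩|² = |⟨π_k(g) 1, h⟩|²`. -/
theorem norm_coeffLowestU_mulHom (k : ℕ) (h : ℂ → ℂ) (lam : Circle) (g : SU11) :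
    ‖coeffLowestU k h (mulHom (lam, g))‖ ^ 2 = ‖coeffLowest k h g‖ ^ 2 := by
  rw [coeffLowestU_mulHom, norm_mul, norm_pow, Circle.norm_coe, one_pow, one_mul]

/-- `|coeffLowestU|²` is invariant under left multiplication by the centre. -/
theorem norm_coeffLowestU_sq_scalarHom_mul (k : ℕ) (h : ℂ → ℂ) (lam : Circle) (g : U11) :
    ‖coeffLowestU k h (scalarHom lam * g)‖ ^ 2 = ‖coeffLowestU k h g‖ ^ 2 := by
  obtain ⟨⟨mu, g'⟩, rfl⟩ := mulHom_surjective g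
  have e : scalarHom lam * mulHom (mu, g') = mulHom (lam * mu, g') := by
    rw [mulHom_apply, mulHom_apply, map_mul, mul_assoc]
  rw [e, norm_coeffLowestU_mulHom, norm_coeffLowestU_mulHom]

/-- On the embedded `SU(1,1)` the coefficient is the `SU(1,1)` one. -/
theorem coeffLowestU_incl (k : ℕ) (h : ℂ → ℂ) (g : SU11) :
    coeffLowestU k h (incl g) = coeffLowest k h g := by
  have : incl g = mulHom (1, g) := by rw [mulHom_apply, map_one, one_mul]
  rw [this, coeffLowestU_mulHom, Circle.coe_one, one_pow, one_mul]

/-- `|coeffLowestU|²` is continuous on `U(1,1)`. -/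
theorem continuous_norm_coeffLowestU_sq (k : ℕ) (hk : 2 ≤ k) (b : ℕ → ℂ) (h : ℂ → ℂ)
    (hh : ∀ w ∈ ball (0 : ℂ) 1, HasSum (fun m => b m * w ^ m) (h w))
    (hint : IntegrableOn (fun w => ‖h w‖ ^ 2 * (1 - ‖w‖ ^ 2) ^ (k - 2)) (ball (0 : ℂ) 1)) :
    Continuous fun g : U11 => ‖coeffLowestU k h g‖ ^ 2 := by
  -- through the (continuous, surjective, open) product map: `F ∘ mulHom` is continuous and `F` is
  -- constant on the fibres; instead we use the explicit formula on `SU(1,1)` and the orbit map of `U(1,1)`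
  have e : (fun g : U11 => ‖coeffLowestU k h g‖ ^ 2) =
      fun g => (π / ((k : ℝ) - 1)) ^ 2 * ((1 - ‖orbitU g‖ ^ 2) ^ k * ‖h (orbitU g)‖ ^ 2) := by
    funext g
    obtain ⟨⟨lam, g'⟩, rfl⟩ := mulHom_surjective g
    rw [norm_coeffLowestU_mulHom, norm_coeffLowest_sq k hk b h hh hint, orbitU_mulHom]
  rw [e]
  have hhc : ContinuousOn h (ball 0 1) := continuousOn_ball b h hh
  have h1 : Continuous fun g : U11 => h (orbitU g) :=
    hhc.comp_continuous continuous_orbitU orbitU_mem_ball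
  exact continuous_const.mul
    (((continuous_const.sub (continuous_orbitU.norm.pow 2)).pow k).mul (h1.norm.pow 2))

variable [MeasurableSpace Circle] [BorelSpace Circle] [MeasurableSpace U11] [BorelSpace U11]

/-- **Integrability against every Haar measure of `U(1,1)`**. -/
theorem integrable_norm_coeffLowestU_sq (μU : Measure U11) [IsHaarMeasure μU] (k : ℕ) (hk : 2 ≤ k)
    (b : ℕ → ℂ) (h : ℂ → ℂ)
    (hh : ∀ w ∈ ball (0 : ℂ) 1, HasSum (fun m => b m * w ^ m) (h w))
    (hint : IntegrableOn (fun w => ‖h w‖ ^ 2 * (1 - ‖w‖ ^ 2) ^ (k - 2)) (ball (0 : ℂ) 1)) :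
    Integrable (fun g => ‖coeffLowestU k h g‖ ^ 2) μU := by
  set c := haarScalarFactor (map mulHom (haarCircle.prod (nu haarCircle))) μU with hc
  have hc0 : c ≠ 0 := (T5U11Product.haarScalarFactor_pos haarCircle (nu haarCircle) μU).ne'
  have hmap : map mulHom (haarCircle.prod (nu haarCircle)) = c • μU :=
    map_mulHom_prod_eq_smul haarCircle (nu haarCircle) μU
  have hmeas : AEStronglyMeasurable (fun g => ‖coeffLowestU k h g‖ ^ 2)
      (map mulHom (haarCircle.prod (nu haarCircle))) :=
    (continuous_norm_coeffLowestU_sq k hk b h hh hint).aestronglyMeasurable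
  have hint' : Integrable (fun g => ‖coeffLowestU k h g‖ ^ 2)
      (map mulHom (haarCircle.prod (nu haarCircle))) := by
    rw [integrable_map_measure hmeas continuous_mulHom.measurable.aemeasurable]
    have e : ((fun g => ‖coeffLowestU k h g‖ ^ 2) ∘ mulHom) =
        fun q : Circle × SU11 => ‖coeffLowest k h q.2‖ ^ 2 := by
      ext q
      exact norm_coeffLowestU_mulHom k h q.1 q.2
    rw [e]
    exact (integrable_norm_coeffLowest_sq (nu haarCircle) k hk b h hh hint).comp_snd haarCircle
  rw [hmap] at hint'
  exact (integrable_smul_measure (ENNReal.coe_ne_zero.mpr hc0) ENNReal.coe_ne_top).mp hint'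

/-- **Schur orthogonality on `H_j = U(1,1)` for the pair `(1, h)`**:
`c_U • ∫_{U(1,1)} |⟨π_k(g) 1, h⟩_k|² dμ_U = (π/(k-1))² ⟨h, h⟩_k` for every Haar measure `μ_U` of `U(1,1)`
and every `h ∈ A_k`, `c_U = haarScalarFactor (map mulHom (haarCircle ⊗ ν)) μ_U`. -/
theorem integral_norm_coeffLowestU_sq (μU : Measure U11) [IsHaarMeasure μU] (k : ℕ) (hk : 2 ≤ k)
    (b : ℕ → ℂ) (h : ℂ → ℂ)
    (hh : ∀ w ∈ ball (0 : ℂ) 1, HasSum (fun m => b m * w ^ m) (h w))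
    (hint : IntegrableOn (fun w => ‖h w‖ ^ 2 * (1 - ‖w‖ ^ 2) ^ (k - 2)) (ball (0 : ℂ) 1)) :
    (haarScalarFactor (map mulHom (haarCircle.prod (nu haarCircle))) μU : ℝ) •
      ∫ g, ‖coeffLowestU k h g‖ ^ 2 ∂μU = (π / ((k : ℝ) - 1)) ^ 2 * (pairing k h h).re := by
  rw [integral_eq_of_scalar_invariant haarCircle (nu haarCircle) μU _
    (integrable_norm_coeffLowestU_sq μU k hk b h hh hint) (norm_coeffLowestU_sq_scalarHom_mul k h),
    haarCircle_univ, ENNReal.toReal_one, one_smul]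
  simp_rw [coeffLowestU_incl]
  have hν := integral_norm_coeffLowest_sq (nu haarCircle) k hk b h hh hint
  rw [haarScalarFactor_self, NNReal.coe_one, one_smul] at hν
  exact hν

/-- The integral over `H_j` is positive for `h ≠ 0` in the space (P3's `Z > 0`, every weight, every `h`). -/
theorem integral_norm_coeffLowestU_sq_pos (μU : Measure U11) [IsHaarMeasure μU] (k : ℕ) (hk : 2 ≤ k)
    (b : ℕ → ℂ) (h : ℂ → ℂ)
    (hh : ∀ w ∈ ball (0 : ℂ) 1, HasSum (fun m => b m * w ^ m) (h w))
    (hint : IntegrableOn (fun w => ‖h w‖ ^ 2 * (1 - ‖w‖ ^ 2) ^ (k - 2)) (ball (0 : ℂ) 1))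
    (hne : 0 < (pairing k h h).re) :
    0 < ∫ g, ‖coeffLowestU k h g‖ ^ 2 ∂μU := by
  have hk1 : (0 : ℝ) < (k : ℝ) - 1 := by
    have : (2 : ℝ) ≤ k := by exact_mod_cast hk
    linarith
  have hI := integral_norm_coeffLowestU_sq μU k hk b h hh hint
  have hc : (0 : ℝ) < haarScalarFactor (map mulHom (haarCircle.prod (nu haarCircle))) μU := by
    exact_mod_cast T5U11Product.haarScalarFactor_pos haarCircle (nu haarCircle) μU
  rw [smul_eq_mul] at hI
  have hpos : (0 : ℝ) < (π / ((k : ℝ) - 1)) ^ 2 * (pairing k h h).re := by positivity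
  rw [← hI] at hpos
  exact pos_of_mul_pos_right hpos hc.le

end Summit.Ventures.HodgeRepro2.T5BergmanSchurU11
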